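import Literature.AlgebraicGeometry.HodgeTheory.FermatHodgeCharacterLocal
import Literature.AlgebraicGeometry.HodgeTheory.FermatHodgeCharacterExistence
import HarnessLib

/-!
# Annihilated twin pairs at the small levels `5, 7, 13, 35` (Aoki 1983, Prop. 8.4 for `ℓ = 4` where no good prime helps)

Topic `Literature/AlgebraicGeometry/HodgeTheory`. THEOREMS only (no definition, no named fact, no `sorry`).

In the uniform treatment of [Aoki1983, Thm. C] at the levels `m = 2m'` resp. `m = 3m'` (routes K₂, K₃ of
the cell's scoping document) the Hodge condition at a conductor `f ∣ m'` pairs every unit coordinate `x̄`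
with its "twin" `v x̄`, `v = -2⁻¹` resp. `v = -3⁻¹` (`c v = -1`, `c ∈ {2, 3}`), and [Aoki1983, Prop. 8.4]
for `ℓ = 4` says: four units `x₀, x₁, v x₀, v x₁` annihilated by the odd primitive characters mod `f`
satisfy `x₁ = -x₀`. Support file XVII (`FermatHodgeCharacterTwinCoprimeSix`) proves this at every level
`f` prime to `6` having a GOOD prime (`p ≥ 11`, or `p ∈ {5, 7}` with `p² ∣ f`), i.e. `f ∤ 35`; the twin-free
matching step of its engine also wants `(-v)^L ≠ 1` (`L ≤ 4`), which for `v = -3⁻¹` fails exactly at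
`f = 13`. This file settles the remaining small levels by Fourier analysis on `(ℤ/f)ˣ` and finite checks:
* **`parityPart_rect_of_orthogonal`** — the local Fourier lemma with TWO sub-conductors: if `F` is
  orthogonal to the parity-`ε` characters factoring neither through `d₁` nor through `d₂`, the
  parity-`ε` part of `F` has vanishing mixed second differences along the fibres of the two reductions
  (for `d₁ = d₂` this is `parityPart_mul_eq_of_orthogonal` of support file II);
* **`twin_pair_small_prime`** — the statement at the prime levels `q ∈ {5, 7, 13}` for both twin factors
  (all odd characters are primitive, the multiplicity function of an annihilated configuration is even,
  and the even configurations `{1, b, v, vb}` have `b = -1`: `decide` over `Fin q`);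
* **`twin_pair_thirtyfive`** — the statement at the level `35` for both twin factors (the odd primitive
  characters mod `35` do not span the odd functions, but ONE rectangle identity of
  `parityPart_rect_of_orthogonal` — at the units `1, 31, 22, 17` for `v = 17`, at `1, 16, 8, 23` for
  `v = 23` — already forces `b = -1`; `decide` over `Fin 35`).

HONEST FRAMING (cell `pub-hfermat`): explicit algebraic cycles for specific Hodge classes on
Fermat/Delsarte varieties; residual open instances listed; no claim on general Hodge. (Surface classes
are algebraic by Lefschetz (1,1); this file is character combinatorics, no case of HC.)

## References
* [Aoki1983] N. Aoki, *On some arithmetic problems related to the Hodge cycles on the Fermat varieties*,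
  Math. Ann. 266 (1983) 23–54 — Prop. 6.1, Prop. 8.4.
-/

noncomputable section

open Finset

namespace Literature.AlgebraicGeometry.HodgeTheory

namespace FermatCharacter

section Fourier

/-- **Local Fourier lemma, two sub-conductors (rectangle form).** Let `F : ℤ/q → ℂ` be orthogonal
to every character of parity `ε` that factors NEITHER through `d₁` nor through `d₂`. Then the
parity-`ε` part `G(x) = F(x) + ε F(-x)` is, on units, a sum of a function of `x mod d₁` and a
function of `x mod d₂`, i.e. its mixed second differences vanish:
`G(w₁) - G(w₂) - G(w₃) + G(w₄) = 0` whenever `w₁ ≡ w₂, w₃ ≡ w₄ (mod d₁)` and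
`w₁ ≡ w₃, w₂ ≡ w₄ (mod d₂)`. (Fourier inversion `φ(q) G(w) = ∑_χ χ(w⁻¹) ⟨G, χ⟩`: `⟨G, χ⟩ = 0`
unless `χ` has parity `ε` and factors through `d₁` or `d₂`, and a character through `d₁` does not
separate `w₁, w₂` nor `w₃, w₄`.) The case `d₁ = d₂` is `parityPart_mul_eq_of_orthogonal`, the engine
behind [Aoki1983, Lemma 4.4 / Prop. 6.3]. [cite: Aoki1983, Prop. 6.1 and Prop. 6.3 (method)] -/
theorem parityPart_rect_of_orthogonal {q d₁ d₂ : ℕ} [NeZero q] (hd₁ : d₁ ∣ q)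
    (hd₂ : d₂ ∣ q) (F : ZMod q → ℂ) {ε : ℂ} (hε : ε = 1 ∨ ε = -1)
    (horth : ∀ χ : DirichletCharacter ℂ q, χ (-1) = ε → ¬ χ.FactorsThrough d₁ →
      ¬ χ.FactorsThrough d₂ → ∑ x : ZMod q, F x * χ x = 0)
    (w₁ w₂ w₃ w₄ : (ZMod q)ˣ) (h12 : ZMod.unitsMap hd₁ w₁ = ZMod.unitsMap hd₁ w₂)
    (h34 : ZMod.unitsMap hd₁ w₃ = ZMod.unitsMap hd₁ w₄)
    (h13 : ZMod.unitsMap hd₂ w₁ = ZMod.unitsMap hd₂ w₃)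
    (h24 : ZMod.unitsMap hd₂ w₂ = ZMod.unitsMap hd₂ w₄) :
    (F w₁ + ε * F (-(w₁ : ZMod q))) - (F w₂ + ε * F (-(w₂ : ZMod q))) -
      (F w₃ + ε * F (-(w₃ : ZMod q))) + (F w₄ + ε * F (-(w₄ : ZMod q))) = 0 := by
  classical
  set G : ZMod q → ℂ := fun x ↦ F x + ε * F (-x) with hG
  -- Fourier coefficients of `G`
  have hcoef : ∀ χ : DirichletCharacter ℂ q,
      ∑ x : ZMod q, G x * χ x = (1 + ε * χ (-1)) * ∑ x : ZMod q, F x * χ x := by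
    intro χ
    have h1 : ∑ x : ZMod q, G x * χ x =
        ∑ x : ZMod q, F x * χ x + ε * ∑ x : ZMod q, F (-x) * χ x := by
      rw [Finset.mul_sum, ← sum_add_distrib]
      refine sum_congr rfl fun x _ ↦ ?_
      simp only [hG]
      ring
    rw [h1, sum_neg_mul_char F χ]
    ring
  have hvan : ∀ χ : DirichletCharacter ℂ q,
      ¬ (χ (-1) = ε ∧ (χ.FactorsThrough d₁ ∨ χ.FactorsThrough d₂)) →
      ∑ x : ZMod q, G x * χ x = 0 := by
    intro χ hχ
    rw [hcoef χ]
    by_cases hpar : χ (-1) = ε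
    · rw [horth χ hpar (fun hft ↦ hχ ⟨hpar, Or.inl hft⟩) (fun hft ↦ hχ ⟨hpar, Or.inr hft⟩),
        mul_zero]
    · have hne : χ (-1) = -ε := by
        rcases char_neg_one_eq_or χ with h1 | h1 <;> rcases hε with rfl | rfl
        · exact absurd h1 hpar
        · rw [h1, neg_neg]
        · rw [h1]
        · exact absurd h1 hpar
      rw [hne]
      rcases hε with rfl | rfl <;> ring
  -- a character through `d` does not separate units congruent mod `d`
  have hsee : ∀ (χ : DirichletCharacter ℂ q) {d : ℕ} (hd : d ∣ q), χ.FactorsThrough d →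
      ∀ u u' : (ZMod q)ˣ, ZMod.unitsMap hd u = ZMod.unitsMap hd u' →
      χ (u : ZMod q)⁻¹ = χ (u' : ZMod q)⁻¹ := by
    intro χ d hd hχ u u' huu
    have hker : ZMod.unitsMap hd (u' * u⁻¹) = 1 := by
      rw [map_mul, map_inv, ← huu, mul_inv_cancel]
    have hk := (DirichletCharacter.factorsThrough_iff_ker_unitsMap hd).mp hχ
      ((MonoidHom.mem_ker).mpr hker)
    rw [MonoidHom.mem_ker] at hk
    have h1 : χ ((u' * u⁻¹ : (ZMod q)ˣ) : ZMod q) = 1 := by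
      have := congrArg (fun z : ℂˣ ↦ (z : ℂ)) hk
      simpa [MulChar.coe_toUnitHom] using this
    rw [ZMod.inv_coe_unit, ZMod.inv_coe_unit,
      show (u⁻¹ : (ZMod q)ˣ) = u'⁻¹ * (u' * u⁻¹) by group, Units.val_mul, map_mul, h1, mul_one]
  -- compare the Fourier expansions
  have key : (q.totient : ℂ) * (G w₁ - G w₂ - G w₃ + G w₄) = 0 := by
    rw [show (q.totient : ℂ) * (G w₁ - G w₂ - G w₃ + G w₄) = (q.totient : ℂ) * G w₁ -
        (q.totient : ℂ) * G w₂ - (q.totient : ℂ) * G w₃ + (q.totient : ℂ) * G w₄ by ring,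
      totient_mul_apply_eq_sum_char G w₁, totient_mul_apply_eq_sum_char G w₂,
      totient_mul_apply_eq_sum_char G w₃, totient_mul_apply_eq_sum_char G w₄,
      ← Finset.sum_sub_distrib, ← Finset.sum_sub_distrib, ← Finset.sum_add_distrib]
    refine Finset.sum_eq_zero fun χ _ ↦ ?_
    by_cases hs : χ (-1) = ε ∧ (χ.FactorsThrough d₁ ∨ χ.FactorsThrough d₂)
    · rcases hs.2 with h1 | h2
      · rw [hsee χ hd₁ h1 w₁ w₂ h12, hsee χ hd₁ h1 w₃ w₄ h34]
        ring
      · rw [hsee χ hd₂ h2 w₁ w₃ h13, hsee χ hd₂ h2 w₂ w₄ h24]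
        ring
    · rw [hvan χ hs]
      ring
  have hφ : (q.totient : ℂ) ≠ 0 := by exact_mod_cast (Nat.totient_pos.mpr (NeZero.pos q)).ne'
  have := (mul_eq_zero.mp key).resolve_left hφ
  simpa [hG] using this

/-- Inducing is transitive: a character through `c` factors through every multiple `d` of `c`
dividing the level. [folklore] -/
private theorem factorsThrough_of_dvd {N c d : ℕ} (χ : DirichletCharacter ℂ N)
    (h : χ.FactorsThrough c) (hcd : c ∣ d) (hdN : d ∣ N) : χ.FactorsThrough d := by
  obtain ⟨hcN, χ₀, hχ⟩ := h
  refine ⟨hdN, DirichletCharacter.changeLevel hcd χ₀, ?_⟩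
  rw [← DirichletCharacter.changeLevel_trans χ₀ hcd hdN]
  convert hχ

/-- A character mod `35` factoring neither through `5` nor through `7` is primitive. [folklore] -/
private theorem isPrimitive_of_not_factorsThrough_five_seven (χ : DirichletCharacter ℂ 35)
    (h5 : ¬ χ.FactorsThrough 5) (h7 : ¬ χ.FactorsThrough 7) : χ.IsPrimitive := by
  have hc : χ.conductor ∣ 35 := χ.conductor_dvd_level
  have hft := χ.factorsThrough_conductor
  have hdiv : χ.conductor = 1 ∨ χ.conductor = 5 ∨ χ.conductor = 7 ∨ χ.conductor = 35 := by
    have h := Nat.mem_divisors.mpr ⟨hc, (by norm_num : (35 : ℕ) ≠ 0)⟩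
    rw [show Nat.divisors 35 = {1, 5, 7, 35} from by decide] at h
    simpa using h
  rcases hdiv with h | h | h | h
  · exact absurd (factorsThrough_of_dvd χ (h ▸ hft) (one_dvd 5) ⟨7, rfl⟩) h5
  · exact absurd (h ▸ hft) h5
  · exact absurd (h ▸ hft) h7
  · exact h

end Fourier

section SmallLevels

/-! ### The finite checks (`ZMod q = Fin q`) -/

/-- Level `5`: an EVEN configuration `{1, b, v, vb}` (`2v = -1` or `3v = -1`) has `b = -1`. [folklore] -/
private theorem twin_pair_dec_five : ∀ v b : Fin 5, (2 * v = -1 ∨ 3 * v = -1) →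
    (∀ y : Fin 5, y ≠ 0 →
      ((if (1 : Fin 5) = y then 1 else 0) + (if b = y then 1 else 0) + (if v = y then 1 else 0) +
          (if v * b = y then 1 else 0) : ℕ) =
        (if (1 : Fin 5) = -y then 1 else 0) + (if b = -y then 1 else 0) + (if v = -y then 1 else 0) +
          (if v * b = -y then 1 else 0)) → b = -1 := by
  decide

/-- Level `7`: an EVEN configuration `{1, b, v, vb}` (`2v = -1` or `3v = -1`) has `b = -1`. [folklore] -/
private theorem twin_pair_dec_seven : ∀ v b : Fin 7, (2 * v = -1 ∨ 3 * v = -1) →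
    (∀ y : Fin 7, y ≠ 0 →
      ((if (1 : Fin 7) = y then 1 else 0) + (if b = y then 1 else 0) + (if v = y then 1 else 0) +
          (if v * b = y then 1 else 0) : ℕ) =
        (if (1 : Fin 7) = -y then 1 else 0) + (if b = -y then 1 else 0) + (if v = -y then 1 else 0) +
          (if v * b = -y then 1 else 0)) → b = -1 := by
  decide

/-- Level `13`: an EVEN configuration `{1, b, v, vb}` (`2v = -1` or `3v = -1`) has `b = -1`. [folklore] -/
private theorem twin_pair_dec_thirteen : ∀ v b : Fin 13, (2 * v = -1 ∨ 3 * v = -1) →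
    (∀ y : Fin 13, y ≠ 0 →
      ((if (1 : Fin 13) = y then 1 else 0) + (if b = y then 1 else 0) + (if v = y then 1 else 0) +
          (if v * b = y then 1 else 0) : ℕ) =
        (if (1 : Fin 13) = -y then 1 else 0) + (if b = -y then 1 else 0) + (if v = -y then 1 else 0) +
          (if v * b = -y then 1 else 0)) → b = -1 := by
  decide

/-- Level `35`, twin factor `v = 17` (`2v = -1`): the rectangle identity at the units `1, 31, 22, 17`
for the odd part of the multiplicity function of `{1, b, v, vb}` forces `b = -1`. [folklore] -/
private theorem twin_pair_dec_thirtyfive_two : ∀ v b : Fin 35, 2 * v = -1 →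
    (let N : Fin 35 → ℕ := (fun y ↦ (if (1 : Fin 35) = y then 1 else 0) +
        (if b = y then 1 else 0) + (if v = y then 1 else 0) + (if v * b = y then 1 else 0));
      ((N 1 : ℕ) : ℤ) + -1 * (N (-1) : ℕ) - ((N 31 : ℕ) + -1 * (N (-31) : ℕ)) -
          ((N 22 : ℕ) + -1 * (N (-22) : ℕ)) + ((N 17 : ℕ) + -1 * (N (-17) : ℕ)) = 0) →
    b = -1 := by
  decide

/-- Level `35`, twin factor `v = 23` (`3v = -1`): the rectangle identity at the units `1, 16, 8, 23`
forces `b = -1`. [folklore] -/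
private theorem twin_pair_dec_thirtyfive_three : ∀ v b : Fin 35, 3 * v = -1 →
    (let N : Fin 35 → ℕ := (fun y ↦ (if (1 : Fin 35) = y then 1 else 0) +
        (if b = y then 1 else 0) + (if v = y then 1 else 0) + (if v * b = y then 1 else 0));
      ((N 1 : ℕ) : ℤ) + -1 * (N (-1) : ℕ) - ((N 16 : ℕ) + -1 * (N (-16) : ℕ)) -
          ((N 8 : ℕ) + -1 * (N (-8) : ℕ)) + ((N 23 : ℕ) + -1 * (N (-23) : ℕ)) = 0) →
    b = -1 := by
  decide

/-! ### Scaling and the multiplicity function -/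

variable {q : ℕ} [NeZero q]

omit [NeZero q] in
/-- Scaling an annihilated twin configuration by `x₀⁻¹`: with `b = x₀⁻¹ x₁`, the configuration
`{1, b, v, vb}` is annihilated by the same characters. [folklore] -/
private theorem scaled_annihilated (x : Fin 2 → (ZMod q)ˣ) (v : (ZMod q)ˣ)
    {χ : DirichletCharacter ℂ q} (hT : ∑ i, χ (x i) + ∑ i, χ (v * x i) = 0) :
    χ 1 + χ (((x 0)⁻¹ * x 1 : (ZMod q)ˣ) : ZMod q) + χ (v : ZMod q) +
      χ ((v : ZMod q) * (((x 0)⁻¹ * x 1 : (ZMod q)ˣ) : ZMod q)) = 0 := by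
  rw [Fin.sum_univ_two, Fin.sum_univ_two] at hT
  have h1 := congrArg (fun z ↦ χ (((x 0)⁻¹ : (ZMod q)ˣ) : ZMod q) * z) hT
  simp only [mul_zero, mul_add, ← map_mul] at h1
  rw [Units.inv_mul, mul_left_comm _ (v : ZMod q) _, Units.inv_mul, mul_one, ← Units.val_mul,
    mul_left_comm _ (v : ZMod q) _, ← Units.val_mul (x 0)⁻¹ (x 1)] at h1
  linear_combination h1

/-- The pairing of the multiplicity function of `{1, b, v, vb}` with a character is the sum of
the character over the configuration. [folklore] -/
private theorem sum_mult_mul_char (b v : ZMod q) (χ : DirichletCharacter ℂ q) :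
    ∑ y : ZMod q, (∑ k, if (![(1 : ZMod q), b, v, v * b]) k = y then (1 : ℂ) else 0) * χ y =
      χ 1 + χ b + χ v + χ (v * b) := by
  classical
  simp only [Finset.sum_mul, ite_mul, one_mul, zero_mul]
  rw [Finset.sum_comm]
  have e : ∀ k, ∑ y : ZMod q, (if (![(1 : ZMod q), b, v, v * b]) k = y then χ y else 0) =
      χ ((![(1 : ZMod q), b, v, v * b]) k) := fun k ↦ by
    rw [Finset.sum_ite_eq, if_pos (Finset.mem_univ _)]
  rw [Finset.sum_congr rfl fun k _ ↦ e k, Fin.sum_univ_four]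
  rfl

omit [NeZero q] in
/-- The multiplicity function of `{1, b, v, vb}` is the cast of a natural-number count. [folklore] -/
private theorem mult_eq_natCast (b v y : ZMod q) :
    (∑ k, if (![(1 : ZMod q), b, v, v * b]) k = y then (1 : ℂ) else 0) =
      (((if (1 : ZMod q) = y then 1 else 0) + (if b = y then 1 else 0) + (if v = y then 1 else 0) +
        (if v * b = y then 1 else 0) : ℕ) : ℂ) := by
  push_cast
  rw [Fin.sum_univ_four]
  rfl

/-- **[Aoki1983, Prop. 8.4, `ℓ = 4`] at the prime levels `5, 7, 13`, for both twin factors**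
(`c v = -1`, `c ∈ {2, 3}`): four units `x₀, x₁, v x₀, v x₁` annihilated by the odd (= odd primitive)
characters mod `q` satisfy `x₁ = -x₀`. By Fourier inversion (`parityPart_mul_eq_of_orthogonal`, `d = 1`)
the multiplicity function of the scaled configuration `{1, b, v, vb}` (`b = x₀⁻¹x₁`) is even on units,
and the finite check gives `b = -1`. [cite: Aoki1983, Prop. 8.4 (ℓ = 4); Prop. 6.1] -/
theorem twin_pair_small_prime (hq : q = 5 ∨ q = 7 ∨ q = 13) (c : ℕ) (hc : c = 2 ∨ c = 3)
    (x : Fin 2 → (ZMod q)ˣ) (v : (ZMod q)ˣ) (hv : (c : ZMod q) * v = -1)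
    (hT : ∀ χ : DirichletCharacter ℂ q, χ.Odd → χ.IsPrimitive →
      ∑ i, χ (x i) + ∑ i, χ (v * x i) = 0) :
    (x 1 : ZMod q) = -x 0 := by
  classical
  have hqp : q.Prime := by rcases hq with rfl | rfl | rfl <;> decide
  haveI : Fact q.Prime := ⟨hqp⟩
  have hv' : (2 : ZMod q) * v = -1 ∨ (3 : ZMod q) * v = -1 := by
    rcases hc with rfl | rfl
    · left; exact_mod_cast hv
    · right; exact_mod_cast hv
  set b : (ZMod q)ˣ := (x 0)⁻¹ * x 1 with hb
  set F : ZMod q → ℂ := fun y ↦ ∑ k, if (![(1 : ZMod q), (b : ZMod q), (v : ZMod q),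
    (v : ZMod q) * b]) k = y then (1 : ℂ) else 0 with hF
  have horth : ∀ χ : DirichletCharacter ℂ q, χ (-1) = -1 → ¬ χ.FactorsThrough 1 →
      ∑ y : ZMod q, F y * χ y = 0 := by
    intro χ hodd hft
    rw [hF, sum_mult_mul_char]
    exact scaled_annihilated x v (hT χ hodd (isPrimitive_of_not_factorsThrough_one_prime hqp χ hft))
  -- evenness on units
  haveI : Subsingleton (ZMod 1) := ZMod.subsingleton_iff.mpr (by norm_num)
  have heven : ∀ y : (ZMod q)ˣ, F y = F (-(y : ZMod q)) := by
    intro y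
    have h1 := parityPart_mul_eq_of_orthogonal (one_dvd q) F (ε := -1) (Or.inr rfl) horth (-1) y
      (Units.ext (Subsingleton.elim _ _))
    simp only [Units.val_neg, Units.val_one, neg_one_mul, neg_neg] at h1
    linear_combination (-1 / 2 : ℂ) * h1
  have hcnt : ∀ y : ZMod q, y ≠ 0 →
      ((if (1 : ZMod q) = y then 1 else 0) + (if (b : ZMod q) = y then 1 else 0) +
          (if (v : ZMod q) = y then 1 else 0) + (if (v : ZMod q) * b = y then 1 else 0) : ℕ) =
        (if (1 : ZMod q) = -y then 1 else 0) + (if (b : ZMod q) = -y then 1 else 0) +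
          (if (v : ZMod q) = -y then 1 else 0) + (if (v : ZMod q) * b = -y then 1 else 0) := by
    intro y hy
    have hyu : IsUnit y := isUnit_iff_ne_zero.mpr hy
    have := heven hyu.unit
    rw [IsUnit.unit_spec] at this
    simp only [hF, mult_eq_natCast] at this
    exact_mod_cast this
  have hb1 : (b : ZMod q) = -1 := by
    rcases hq with rfl | rfl | rfl
    · exact twin_pair_dec_five _ _ hv' hcnt
    · exact twin_pair_dec_seven _ _ hv' hcnt
    · exact twin_pair_dec_thirteen _ _ hv' hcnt
  calc (x 1 : ZMod q) = (x 0 : ZMod q) * b := by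
        rw [hb, Units.val_mul, Units.mul_inv_cancel_left]
    _ = -x 0 := by rw [hb1, mul_neg_one]

/-- **[Aoki1983, Prop. 8.4, `ℓ = 4`] at the level `35`, for both twin factors** (`c v = -1`,
`c ∈ {2, 3}`; the one level prime to `6` with neither a good prime nor all odd characters primitive):
four units `x₀, x₁, v x₀, v x₁` annihilated by the odd PRIMITIVE characters mod `35` satisfy
`x₁ = -x₀`. The odd part of the multiplicity function of the scaled configuration `{1, b, v, vb}` has
vanishing mixed second differences along the reductions mod `5` and mod `7`
(`parityPart_rect_of_orthogonal`), and one rectangle (`1, 31, 22, 17` for `v = 17`; `1, 16, 8, 23` for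
`v = 23`) forces `b = -1` (finite check). [cite: Aoki1983, Prop. 8.4 (ℓ = 4); Prop. 6.1] -/
theorem twin_pair_thirtyfive (hq : q = 35) (c : ℕ) (hc : c = 2 ∨ c = 3) (x : Fin 2 → (ZMod q)ˣ)
    (v : (ZMod q)ˣ) (hv : (c : ZMod q) * v = -1)
    (hT : ∀ χ : DirichletCharacter ℂ q, χ.Odd → χ.IsPrimitive →
      ∑ i, χ (x i) + ∑ i, χ (v * x i) = 0) :
    (x 1 : ZMod q) = -x 0 := by
  classical
  subst hq
  set b : (ZMod 35)ˣ := (x 0)⁻¹ * x 1 with hb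
  set F : ZMod 35 → ℂ := fun y ↦ ∑ k, if (![(1 : ZMod 35), (b : ZMod 35), (v : ZMod 35),
    (v : ZMod 35) * b]) k = y then (1 : ℂ) else 0 with hF
  have horth : ∀ χ : DirichletCharacter ℂ 35, χ (-1) = -1 → ¬ χ.FactorsThrough 5 →
      ¬ χ.FactorsThrough 7 → ∑ y : ZMod 35, F y * χ y = 0 := by
    intro χ hodd h5 h7
    rw [hF, sum_mult_mul_char]
    exact scaled_annihilated x v (hT χ hodd (isPrimitive_of_not_factorsThrough_five_seven χ h5 h7))
  have h5 : (5 : ℕ) ∣ 35 := ⟨7, rfl⟩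
  have h7 : (7 : ℕ) ∣ 35 := ⟨5, rfl⟩
  have hmap : ∀ {d : ℕ} (hd : d ∣ 35) (u u' : (ZMod 35)ˣ),
      ZMod.castHom hd (ZMod d) (u : ZMod 35) = ZMod.castHom hd (ZMod d) u' →
      ZMod.unitsMap hd u = ZMod.unitsMap hd u' := by
    intro d hd u u' h
    exact Units.ext (by rw [coe_unitsMap, coe_unitsMap]; exact h)
  set N : ZMod 35 → ℕ := fun y ↦ (if (1 : ZMod 35) = y then 1 else 0) +
      (if (b : ZMod 35) = y then 1 else 0) + (if (v : ZMod 35) = y then 1 else 0) +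
      (if (v : ZMod 35) * b = y then 1 else 0) with hN
  have hcount : ∀ y : ZMod 35, F y = ((N y : ℕ) : ℂ) := fun y ↦ by
    rw [hF, hN]; exact mult_eq_natCast _ _ y
  -- the rectangle, depending on the twin factor
  have hb1 : (b : ZMod 35) = -1 := by
    rcases hc with rfl | rfl
    · have hv2 : (2 : ZMod 35) * v = -1 := by exact_mod_cast hv
      set w₁ : (ZMod 35)ˣ := ZMod.unitOfCoprime 1 (by decide) with hw₁
      set w₂ : (ZMod 35)ˣ := ZMod.unitOfCoprime 31 (by decide) with hw₂
      set w₃ : (ZMod 35)ˣ := ZMod.unitOfCoprime 22 (by decide) with hw₃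
      set w₄ : (ZMod 35)ˣ := ZMod.unitOfCoprime 17 (by decide) with hw₄
      have e12 : ZMod.unitsMap h5 w₁ = ZMod.unitsMap h5 w₂ := hmap h5 _ _ (by
        rw [hw₁, hw₂, ZMod.coe_unitOfCoprime, ZMod.coe_unitOfCoprime, map_natCast, map_natCast]
        decide)
      have e34 : ZMod.unitsMap h5 w₃ = ZMod.unitsMap h5 w₄ := hmap h5 _ _ (by
        rw [hw₃, hw₄, ZMod.coe_unitOfCoprime, ZMod.coe_unitOfCoprime, map_natCast, map_natCast]
        decide)
      have e13 : ZMod.unitsMap h7 w₁ = ZMod.unitsMap h7 w₃ := hmap h7 _ _ (by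
        rw [hw₁, hw₃, ZMod.coe_unitOfCoprime, ZMod.coe_unitOfCoprime, map_natCast, map_natCast]
        decide)
      have e24 : ZMod.unitsMap h7 w₂ = ZMod.unitsMap h7 w₄ := hmap h7 _ _ (by
        rw [hw₂, hw₄, ZMod.coe_unitOfCoprime, ZMod.coe_unitOfCoprime, map_natCast, map_natCast]
        decide)
      have hrect := parityPart_rect_of_orthogonal h5 h7 F (ε := -1) (Or.inr rfl) horth w₁ w₂ w₃ w₄
        e12 e34 e13 e24
      rw [hw₁, hw₂, hw₃, hw₄, ZMod.coe_unitOfCoprime, ZMod.coe_unitOfCoprime,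
        ZMod.coe_unitOfCoprime, ZMod.coe_unitOfCoprime, Nat.cast_one] at hrect
      simp only [Nat.cast_ofNat] at hrect
      rw [hcount, hcount, hcount, hcount, hcount, hcount, hcount, hcount] at hrect
      have hZ : ((N 1 : ℕ) : ℤ) + -1 * (N (-1) : ℕ) - ((N 31 : ℕ) + -1 * (N (-31) : ℕ)) -
          ((N 22 : ℕ) + -1 * (N (-22) : ℕ)) + ((N 17 : ℕ) + -1 * (N (-17) : ℕ)) = 0 := by
        exact_mod_cast hrect
      refine twin_pair_dec_thirtyfive_two (v : ZMod 35) (b : ZMod 35) hv2 ?_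
      exact hZ
    · have hv3 : (3 : ZMod 35) * v = -1 := by exact_mod_cast hv
      set w₁ : (ZMod 35)ˣ := ZMod.unitOfCoprime 1 (by decide) with hw₁
      set w₂ : (ZMod 35)ˣ := ZMod.unitOfCoprime 16 (by decide) with hw₂
      set w₃ : (ZMod 35)ˣ := ZMod.unitOfCoprime 8 (by decide) with hw₃
      set w₄ : (ZMod 35)ˣ := ZMod.unitOfCoprime 23 (by decide) with hw₄
      have e12 : ZMod.unitsMap h5 w₁ = ZMod.unitsMap h5 w₂ := hmap h5 _ _ (by
        rw [hw₁, hw₂, ZMod.coe_unitOfCoprime, ZMod.coe_unitOfCoprime, map_natCast, map_natCast]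
        decide)
      have e34 : ZMod.unitsMap h5 w₃ = ZMod.unitsMap h5 w₄ := hmap h5 _ _ (by
        rw [hw₃, hw₄, ZMod.coe_unitOfCoprime, ZMod.coe_unitOfCoprime, map_natCast, map_natCast]
        decide)
      have e13 : ZMod.unitsMap h7 w₁ = ZMod.unitsMap h7 w₃ := hmap h7 _ _ (by
        rw [hw₁, hw₃, ZMod.coe_unitOfCoprime, ZMod.coe_unitOfCoprime, map_natCast, map_natCast]
        decide)
      have e24 : ZMod.unitsMap h7 w₂ = ZMod.unitsMap h7 w₄ := hmap h7 _ _ (by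
        rw [hw₂, hw₄, ZMod.coe_unitOfCoprime, ZMod.coe_unitOfCoprime, map_natCast, map_natCast]
        decide)
      have hrect := parityPart_rect_of_orthogonal h5 h7 F (ε := -1) (Or.inr rfl) horth w₁ w₂ w₃ w₄
        e12 e34 e13 e24
      rw [hw₁, hw₂, hw₃, hw₄, ZMod.coe_unitOfCoprime, ZMod.coe_unitOfCoprime,
        ZMod.coe_unitOfCoprime, ZMod.coe_unitOfCoprime, Nat.cast_one] at hrect
      simp only [Nat.cast_ofNat] at hrect
      rw [hcount, hcount, hcount, hcount, hcount, hcount, hcount, hcount] at hrect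
      have hZ : ((N 1 : ℕ) : ℤ) + -1 * (N (-1) : ℕ) - ((N 16 : ℕ) + -1 * (N (-16) : ℕ)) -
          ((N 8 : ℕ) + -1 * (N (-8) : ℕ)) + ((N 23 : ℕ) + -1 * (N (-23) : ℕ)) = 0 := by
        exact_mod_cast hrect
      refine twin_pair_dec_thirtyfive_three (v : ZMod 35) (b : ZMod 35) hv3 ?_
      exact hZ
  calc (x 1 : ZMod 35) = (x 0 : ZMod 35) * b := by
        rw [hb, Units.val_mul, Units.mul_inv_cancel_left]
    _ = -x 0 := by rw [hb1, mul_neg_one]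

end SmallLevels

end FermatCharacter

end Literature.AlgebraicGeometry.HodgeTheory
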